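import Summits.SmoothPoincare4.SmoothPoincare4.Theorems.CongruenceShadowsNormalFormStablyTrivialLuftStubMovesGoeritzAux2
import Summits.SmoothPoincare4.SmoothPoincare4.Theorems.CongruenceShadowsNormalFormStablyTrivialLuftStubMovesGoeritzAux3
import Summits.SmoothPoincare4.SmoothPoincare4.Theorems.CongruenceShadowsNormalFormStablyTrivialLuftStubMovesGoeritzAux4
import Summits.SmoothPoincare4.SmoothPoincare4.Theorems.CongruenceShadowsNormalFormStablyTrivialLuftStubMovesGoeritzAux5

/-!
# Stub `stub_movesGoeritz` of line `luft-twist-reduction` for crux `NormalFormStablyTrivial`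
# (item stmt-SmoothPoincare4-14591, route `CongruenceShadows`) — the padding moves are Goeritz-induced

Proves the registered stub **`stub_movesGoeritz : MovesGoeritz`** verbatim (`…LuftDefs.lean` §4):
every PADDING MOVE of `F_{3+3m} = S ⧸ N₁ = π₁(H₁)` — a right transvection `xᵢ ↦ xᵢ x_t` BY a
TRIVIAL letter (`t ≢ 0 (mod 3)`, `i ≠ t` of either type) or a partial conjugation
`x_t ↦ x_j⁻¹ x_t x_j` OF a trivial letter (`j ≠ t` of either type) — is induced through the
erasure `eraseN1 : S_{3+3m} →* F_{3+3m}` by an automorphism of the surface group stabilising BOTH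
standard kernels `N m 0`, `N m 1`, i.e. by an element of the Goeritz group of the standard
genus-`3(m+1)` Heegaard splitting of `#^{m+1} S¹×S²` (`θ ∈ goeritzInduced m`).

Assembly of the sibling files: in the `a`-normalisation (`…Aux.lean`: cut system `{aᵢ}` and the
pattern `d i = (i % 3 ≠ 0)` of trivial handles) the transvections are realised by the handle
slides corrected by a meridian transvection (`helper_movesGoeritz_4`: `i < t`, `…Aux4.lean`;
`helper_movesGoeritz_5`: `i > t`, `…Aux5.lean`) and the partial conjugations by the drags of the
knob `t` around the handle `j` (`helper_movesGoeritz_2`: `t < j`, `…Aux2.lean`;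
`helper_movesGoeritz_3`: `t > j`, `…Aux3.lean`); each realiser stabilises `⟪aᵢ⟫` because it
induces an automorphism through `eraseA` (`map_aKernel_eq_of_eraseA`), and is transported to the
standard kernels by the cut swap of slot `1` (`helper_movesGoeritz_1`).

References: Luft, Math. Ann. 234 (1978); Griffiths, Abh. Math. Sem. Univ. Hamburg 26 (1964);
Zieschang–Vogt–Coldewey, LNM 835 (1980) §3.6.
-/

-- the prescribed namespace `Summit.<P>.<Sub>.…` duplicates `SmoothPoincare4` (P = Sub)
set_option linter.dupNamespace false

noncomputable section

namespace Summit.SmoothPoincare4.SmoothPoincare4.Theorems.NormalFormStablyTrivial.Luft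

open Literature.Topology.FourManifolds Literature.GroupTheory.CombinatorialGroupTheory Subgroup

/-- The pattern of trivial handles takes the value `true` at a trivial letter. [folklore] -/
theorem dPat_apply_eq_true {m : ℕ} {t : Fin (3 + 3 * m)} (ht : (t : ℕ) % 3 ≠ 0) :
    (fun i : Fin (3 + 3 * m) => decide ((i : ℕ) % 3 ≠ 0)) t = true := by
  simpa using ht

/-- **A right transvection by a trivial letter is Goeritz-induced**: for `t % 3 ≠ 0` and `i ≠ t`,
`nielsenBeta i t : xᵢ ↦ xᵢ x_t` lies in `goeritzInduced m` (corrected handle slide of `i` over the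
knob `t`, transported by the cut swap of slot `1`). [folklore] -/
theorem nielsenBeta_mem_goeritzInduced {m : ℕ} {i t : Fin (3 + 3 * m)} (h : i ≠ t)
    (ht : (t : ℕ) % 3 ≠ 0) : nielsenBeta i t h ∈ goeritzInduced m := by
  rcases lt_or_gt_of_ne h with hlt | hgt
  · obtain ⟨y, hD, hE⟩ := helper_movesGoeritz_4 _ i t hlt
      (fun i : Fin (3 + 3 * m) => decide ((i : ℕ) % 3 ≠ 0)) (dPat_apply_eq_true ht)
    exact helper_movesGoeritz_1 m _ y (map_aKernel_eq_of_eraseA y _ hE) hD hE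
  · obtain ⟨y, hD, hE⟩ := helper_movesGoeritz_5 _ t i hgt
      (fun i : Fin (3 + 3 * m) => decide ((i : ℕ) % 3 ≠ 0)) (dPat_apply_eq_true ht)
    exact helper_movesGoeritz_1 m _ y (map_aKernel_eq_of_eraseA y _ hE) hD hE

/-- **A partial conjugation of a trivial letter is Goeritz-induced**: for `t % 3 ≠ 0` and `j ≠ t`,
`partialConj t j : x_t ↦ x_j⁻¹ x_t x_j` lies in `goeritzInduced m` (drag of the knob `t` around
the handle `j`, transported by the cut swap of slot `1`). [folklore] -/
theorem partialConj_mem_goeritzInduced {m : ℕ} {t j : Fin (3 + 3 * m)} (h : t ≠ j)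
    (ht : (t : ℕ) % 3 ≠ 0) : partialConj t j h ∈ goeritzInduced m := by
  rcases lt_or_gt_of_ne h with hlt | hgt
  · obtain ⟨y, hD, hE⟩ := helper_movesGoeritz_2 _ t j hlt
      (fun i : Fin (3 + 3 * m) => decide ((i : ℕ) % 3 ≠ 0)) (dPat_apply_eq_true ht)
    exact helper_movesGoeritz_1 m _ y (map_aKernel_eq_of_eraseA y _ hE) hD hE
  · obtain ⟨y, hD, hE⟩ := helper_movesGoeritz_3 _ j t hgt
      (fun i : Fin (3 + 3 * m) => decide ((i : ℕ) % 3 ≠ 0)) (dPat_apply_eq_true ht)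
    exact helper_movesGoeritz_1 m _ y (map_aKernel_eq_of_eraseA y _ hE) hD hE

/-- **`MovesGoeritz` (registered stub `stub_movesGoeritz`)**: every padding move of `F_{3+3m}`
(right transvection by a trivial letter, partial conjugation of a trivial letter) is induced
through `eraseN1` by an element of the Goeritz group `Stab N₀ ∩ Stab N₁` of the standard Heegaard
splitting of `#^{m+1} S¹×S²`. [folklore] -/
theorem stub_movesGoeritz : MovesGoeritz := by
  rintro m θ (⟨i, t, h, ht, rfl⟩ | ⟨t, j, h, ht, rfl⟩)
  · exact nielsenBeta_mem_goeritzInduced h ht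
  · exact partialConj_mem_goeritzInduced h ht

end Summit.SmoothPoincare4.SmoothPoincare4.Theorems.NormalFormStablyTrivial.Luft

end
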